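import Literature.Topology.FourManifolds.TautFoliationsNovikov
import Literature.AlgebraicTopology.SingularHomology.HurewiczProofs
import HarnessLib

/-!
# Property R two levels down: the Hurewicz and Seifert hypotheses discharged

Sibling proof file of `TautFoliationsNovikov.lean`, which proved the genus-`0` statement on
`S² × S¹` (every compact leaf of a transversely oriented taut `C⁰` foliation of `S² × S¹` has genus
`0`: `Literature.Topology.FourManifolds.Foliation.genus_eq_zero_of_isTaut_sphereTwo_prod_sphereOne_of_novikov`) and the
reduction `Literature.Topology.FourManifolds.isUnknot_of_isIntegralSurgery_zero_of_novikov_hurewicz` of Gabai's Property R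
theorem (`Literature.Topology.FourManifolds.isUnknot_of_isIntegralSurgery_zero`, `spc4.S25`) to five named facts: Novikov's
theorem (`Literature.Topology.FourManifolds.Foliation.fundamentalGroup_map_injective_of_isTaut`), the Hurewicz theorem in
degree one (`Literature.AlgebraicTopology.SingularHomology.singularHomology.hurewicz_one`), Gabai's Corollary 8.2
(`Literature.Topology.FourManifolds.Knot.exists_isTaut_hasCompactLeafOfGenus_of_isIntegralSurgery_zero`), the existence of
Seifert surfaces (`Literature.Topology.FourManifolds.Knot.exists_hasSeifertSurfaceOfGenus`) and "genus `0` iff unknot"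
(`Literature.Topology.FourManifolds.Knot.genus_eq_zero_iff_isUnknot`). Two of the five hypotheses are removed here:

* the Hurewicz theorem is now **proved** (`Literature.AlgebraicTopology.SingularHomology.singularHomology.hurewicz_one_holds`,
  `Literature/AlgebraicTopology/SingularHomology/HurewiczProofs.lean`, Hatcher Thm. 2A.1):
  `Literature.Topology.FourManifolds.Foliation.genus_eq_zero_of_isTaut_sphereTwo_prod_sphereOne_of_novikov'` — every compact
  leaf of a transversely oriented taut `C⁰` foliation of `S² × S¹` has genus `0`, from Novikov's
  theorem alone;
* the existence of Seifert surfaces is **not needed** for the statement `K.genus = 0`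
  (`Literature.Topology.FourManifolds.Knot.genus_eq_zero_of_isIntegralSurgery_zero_of_novikov'`): `Literature.Topology.FourManifolds.Knot.genus` is the
  infimum `sInf {g | K.HasSeifertSurfaceOfGenus g}` (`SliceGenus.lean`); if this set is nonempty
  its infimum is attained (`Nat.sInf_mem`), which is all that Gabai's Corollary 8.2 (stated for a
  knot with a minimal genus Seifert surface) requires, and if it were empty the infimum is `0` by
  convention (`Nat.sInf_empty`). (Seifert's theorem, Seifert (1934), says the first case always
  occurs; the case split merely avoids importing it as a hypothesis.)

Hence `Literature.Topology.FourManifolds.isUnknot_of_isIntegralSurgery_zero_of_novikov'`: Property R follows from the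
three named facts Novikov (Gabai (1983), Thm. 2.8 (4)), Gabai (1987), Cor. 8.2, and "genus `0`
iff unknot" (Dehn's lemma; Papakyriakopoulos (1957)).

Remarks on the citation of Novikov's theorem in `TautFoliationsNovikov.lean` (review notes,
recorded here): Bowden (2016), Thm. 2.7 as printed excludes "the product foliation on
`S² × S¹`" (where the conclusion holds trivially, the leaves being spheres —
`Literature.Topology.FourManifolds.Foliation.fundamentalGroup_map_injective_productSpheres`), while Gabai (1983), Thm. 2.8 (4)
has no such exclusion; and the implication "taut ⇒ no Reeb components" used to match the printed
hypothesis is Schultens (2014), Lemma 7.5.14 (Gabai (1983), Def. 2.11 lists "no Reeb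
components" as a separate clause of tautness).

## References

* D. Gabai, *Foliations and the topology of 3-manifolds*, J. Differential Geom. 18 (1983),
  Thm. 2.8 (4) [Gabai1983]; *… III*, J. Differential Geom. 26 (1987), Cor. 8.2, Cor. 8.3,
  Remark 8.5 [GabaiJDG1987].
* A. Hatcher, *Algebraic Topology* (2002), Thm. 2A.1 [HatcherAT2002].
-/

open scoped Manifold ContDiff Topology

noncomputable section

namespace Literature.Topology.FourManifolds

/-- Local notation: `𝔼 n` is the model Euclidean space `EuclideanSpace ℝ (Fin n)`. -/
local notation "𝔼 " n:arg => EuclideanSpace ℝ (Fin n)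

/-- Local notation: `𝕊 n` is the unit sphere in `EuclideanSpace ℝ (Fin (n + 1))`. -/
local notation "𝕊 " n:arg => (Metric.sphere (0 : EuclideanSpace ℝ (Fin (n + 1))) 1)

/-- **Every compact leaf of a transversely oriented taut foliation of `S² × S¹` has genus `0`,
from Novikov's theorem** (Novikov's theorem on `S² × S¹` in consequence form — Schultens (2014),
Thm. 7.5.12 (iii) with Lemma 7.5.14; Gabai (1983), Thm. 2.8 (3) — spelled out in full, now modulo
Novikov's `π₁`-injectivity of leaves only): the Hurewicz hypothesis of
`genus_eq_zero_of_isTaut_sphereTwo_prod_sphereOne_of_novikov` is discharged by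
`singularHomology.hurewicz_one_holds` (Hatcher, Thm. 2A.1, proved in `HurewiczProofs.lean`).
[cite: Gabai1983, Thm. 2.8 (4); HatcherAT2002, Thm. 2A.1] -/
theorem Foliation.genus_eq_zero_of_isTaut_sphereTwo_prod_sphereOne_of_novikov'
    (hN : Foliation.fundamentalGroup_map_injective_of_isTaut.{0}) :
    ∀ F : Foliation (𝔼 2) ((𝕊 2) × (𝕊 1)), F.IsTransverselyOriented → F.IsTaut →
      ∀ g : ℕ, F.HasCompactLeafOfGenus g → g = 0 :=
  Foliation.genus_eq_zero_of_isTaut_sphereTwo_prod_sphereOne_of_novikov hN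
    Literature.AlgebraicTopology.SingularHomology.singularHomology.hurewicz_one_holds

/-- **Zero surgery `S² × S¹` forces genus `0`, by Novikov on `S² × S¹` and Gabai's Corollary 8.2**
(as `Knot.genus_eq_zero_of_isIntegralSurgery_zero_of_novikov` of `TautFoliations.lean`, without
the hypothesis `Knot.exists_hasSeifertSurfaceOfGenus`): if `↥(𝕊 2) × ↥(𝕊 1)` is a `0`-surgery on
`K` then `K.genus = 0`. If `K` bounds some Seifert surface, the least genus `K.genus` is attained
(`Nat.sInf_mem`), Corollary 8.2 gives a transversely oriented taut foliation of `S² × S¹` with a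
compact leaf of genus `K.genus`, and the genus-`0` fact for `S² × S¹` gives `K.genus = 0`;
otherwise `K.genus = sInf ∅ = 0` by the definition of `Knot.genus` (`Nat.sInf_empty`; this case
does not occur by Seifert (1934), which is therefore not needed as a hypothesis). The hypothesis
`hN` is Novikov's theorem on `S² × S¹` in consequence form (every compact leaf of a transversely
oriented taut `C⁰` foliation of `S² × S¹` has genus `0`; Schultens (2014), Thm. 7.5.12 (iii) with
Lemma 7.5.14), spelled out; it is `Foliation.genus_eq_zero_of_isTaut_sphereTwo_prod_sphereOne_of_novikov' h`
for `h` Novikov's `π₁`-injectivity theorem `Foliation.fundamentalGroup_map_injective_of_isTaut`.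
[cite: GabaiJDG1987, Cor. 8.2, Cor. 8.3 and Remark 8.5] -/
theorem Knot.genus_eq_zero_of_isIntegralSurgery_zero_of_novikov'
    (hN : ∀ F : Foliation (𝔼 2) ((𝕊 2) × (𝕊 1)), F.IsTransverselyOriented → F.IsTaut →
      ∀ g : ℕ, F.HasCompactLeafOfGenus g → g = 0)
    (h82 : Knot.exists_isTaut_hasCompactLeafOfGenus_of_isIntegralSurgery_zero.{0}) (K : Knot)
    (h : IsIntegralSurgery ((𝓡 2).prod (𝓡 1)) ((𝕊 2) × (𝕊 1)) K 0) : K.genus = 0 := by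
  by_cases hne : {g | K.HasSeifertSurfaceOfGenus g}.Nonempty
  · obtain ⟨F, ho, ht, hg⟩ := h82 K K.genus ⟨Nat.sInf_mem hne, fun _ hg ↦ Nat.sInf_le hg⟩
      ((𝓡 2).prod (𝓡 1)) ((𝕊 2) × (𝕊 1)) h
    exact hN F ho ht K.genus hg
  · show sInf {g | K.HasSeifertSurfaceOfGenus g} = 0
    rw [Set.not_nonempty_iff_eq_empty.1 hne, Nat.sInf_empty]

variable [SphereEmbedding.SmoothnessFacts] in
/-- **Property R from three named facts** (proved reduction of `spc4.S25`, two hypotheses fewer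
than `SPC4.isUnknot_of_isIntegralSurgery_zero_of_novikov_hurewicz`): Novikov's theorem
(`Foliation.fundamentalGroup_map_injective_of_isTaut`; Gabai (1983), Thm. 2.8 (4)), Gabai's
Corollary 8.2 (`Knot.exists_isTaut_hasCompactLeafOfGenus_of_isIntegralSurgery_zero`) and
"genus `0` iff unknot" (`Knot.genus_eq_zero_iff_isUnknot`; Papakyriakopoulos (1957)) imply
`isUnknot_of_isIntegralSurgery_zero`: if `S² × S¹` is `0`-surgery on a knot `K ⊆ S³` then `K`
is the unknot — Gabai (1987), proof of Cor. 8.3 and Remark 8.5 in the case `M = S² × S¹`, with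
"Novikov" entering through the `π₁`-injectivity of leaves, `π₁(S² × S¹)` cyclic and the (proved)
Hurewicz theorem in degree one. [cite: GabaiJDG1987, Cor. 8.2, Cor. 8.3 and Remark 8.5] -/
theorem isUnknot_of_isIntegralSurgery_zero_of_novikov'
    (hN : Foliation.fundamentalGroup_map_injective_of_isTaut.{0})
    (h82 : Knot.exists_isTaut_hasCompactLeafOfGenus_of_isIntegralSurgery_zero.{0})
    (hD : Knot.genus_eq_zero_iff_isUnknot) :
    FourManifolds.isUnknot_of_isIntegralSurgery_zero := by
  intro K h
  exact (hD K).1 (Knot.genus_eq_zero_of_isIntegralSurgery_zero_of_novikov'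
    (Foliation.genus_eq_zero_of_isTaut_sphereTwo_prod_sphereOne_of_novikov' hN) h82 K h)

end Literature.Topology.FourManifolds
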